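import Mathlib
import Literature.NumberTheory.LFunctions.Zhang2022.Section7cLPolyLargeSieve
import Literature.NumberTheory.LFunctions.Zhang2022.Section7Step7bTruncI
import HarnessLib

/-!
# Zhang (2022) §7, G-adj2-1 extended range (F2a): large sieve and `𝔌(Rh)`-localisation for `r ≥ D`

Topic `Literature/NumberTheory/LFunctions/Zhang2022` (Landau–Siegel audit tree; verdict-neutral).
Y. Zhang, *Discrete mean estimates and the Landau–Siegel zero*, arXiv:2211.02515v1 (2022)
[Zhang2022LandauSiegel] — **an unrefereed manuscript under adjudication**. D-0069 campaign, cell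
`siegel-zhang`, §7 error-term subsection, GAP-LEDGER row G-adj2-1 discharge lane (the printed
(7.13)/(7.15) range `dhr < P₁` vs the (7.2) support `dhr < PT⁻²`).

The X-RANGE for the dyadic parameter `R` of (7.15) is `D ≤ R` and `R·dh ≤ PT⁻²` — the full
(7.2)-support range, with no `dhr < P₁` restriction. This file supplies the two per-block
ingredients of the extended-range (7.15) whose landed forms are stated only on the printed range:

* `step7u039X` — the `§7.u039` large-sieve bound for the `l`-polynomial on the X-range. The only
  printed-range uses in the landed `step7u039_holds` are `Rh ≤ P₁` (for `log⌊4Pt₀Rh⌋ ≤ 524𝓛⁹`)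
  and `R ≤ P`; both survive on the X-range via `Rh ≤ R·dh ≤ PT⁻² ≤ P` with the SAME constants.
* `step7bTruncIX` — the `l ∉ 𝔌(Rh)` localisation `|𝔰 − 𝔰*| ≤ exp(−c𝓛¹⁰)` on the X-range
  (the landed `Section7TruncI.step7bTruncI_holds` route: the far-region bound
  `DeltaFar.norm_DeltaW_le_of_far` with the `l⁻²`-summable majorant; the printed-range facts
  `d ≤ P`, `hR ≤ P` are re-derived from `R·dh ≤ PT⁻² ≤ P`).

Theorems only; 0 new definitions; 0 new facts. The Cauchy composition, the budget
`R^{1/2} ≤ P^{1/2}T⁻¹` and the block bound are the companion file (F2b) of the same rung; the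
per-triple `1 < r < D` inputs are `Section7ExtendedRangeTail` (F1, p430402).

WHAT THIS IS NOT: any claim about Theorems 1–2 of the manuscript or about Landau–Siegel zeros;
not a proof of (7.11), (7.13) or (7.15); no change to the G-adj2-1 row.

## References

* Y. Zhang, arXiv:2211.02515v1 (2022), §7 pp. 38–39, (7.15), §7.u037–u039, tex L2028–L2051;
  §5 Lemma 5.3. [cite: Zhang2022LandauSiegel, §7 pp. 38–39]
-/

noncomputable section

open Complex Real Finset

namespace Literature.NumberTheory.LFunctions.Zhang2022.Section7cStatements

open Literature.NumberTheory.LFunctions.Zhang2022.Skeleton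

open scoped Classical

/-! ## Elementary helpers (local copies of private lemmas of the lane, unchanged) -/

/-- `τ_j(mn) ≤ τ_j(m)τ_j(n)` (local copy). [folklore] -/
private theorem tau_mul_leX (j m n : ℕ) :
    MeanSquareMajorant.tau j (m * n) ≤ MeanSquareMajorant.tau j m * MeanSquareMajorant.tau j n := by
  induction j generalizing m n with
  | zero =>
    simp only [MeanSquareMajorant.tau_zero, ArithmeticFunction.one_apply, mul_eq_one]
    by_cases hm : m = 1
    · by_cases hn : n = 1
      · simp [hm, hn]
      · simp [hm, hn]
    · simp [hm]
  | succ j ih =>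
    rcases Nat.eq_zero_or_pos m with rfl | hm
    · simp only [zero_mul, ArithmeticFunction.map_zero]
      exact le_of_eq (by ring)
    rcases Nat.eq_zero_or_pos n with rfl | hn
    · simp only [mul_zero, ArithmeticFunction.map_zero]
      exact le_of_eq (by ring)
    rw [MeanSquareMajorant.tau_succ_apply, MeanSquareMajorant.tau_succ_apply,
      MeanSquareMajorant.tau_succ_apply, Finset.sum_mul_sum, ← Finset.sum_product']
    have hsub : (m * n).divisors ⊆ (m.divisors ×ˢ n.divisors).image (fun x => x.1 * x.2) := by
      intro e he
      have hd := Nat.dvd_of_mem_divisors he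
      obtain ⟨e₁, e₂, h₁, h₂, rfl⟩ := Nat.dvd_mul.mp hd
      exact Finset.mem_image.mpr ⟨(e₁, e₂), Finset.mem_product.mpr
        ⟨Nat.mem_divisors.mpr ⟨h₁, hm.ne'⟩, Nat.mem_divisors.mpr ⟨h₂, hn.ne'⟩⟩, rfl⟩
    calc ∑ e ∈ (m * n).divisors, MeanSquareMajorant.tau j e
        ≤ ∑ e ∈ (m.divisors ×ˢ n.divisors).image (fun x => x.1 * x.2), MeanSquareMajorant.tau j e :=
          Finset.sum_le_sum_of_subset_of_nonneg hsub fun _ _ _ => MeanSquareMajorant.tau_nonneg _ _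
      _ ≤ ∑ x ∈ m.divisors ×ˢ n.divisors, MeanSquareMajorant.tau j (x.1 * x.2) :=
          Finset.sum_image_le_of_nonneg fun _ _ => MeanSquareMajorant.tau_nonneg _ _
      _ ≤ ∑ x ∈ m.divisors ×ˢ n.divisors,
            MeanSquareMajorant.tau j x.1 * MeanSquareMajorant.tau j x.2 :=
          Finset.sum_le_sum fun x _ => ih x.1 x.2

/-- Domination of a Dirichlet product from dominations of the factors (local copy). [folklore] -/
private theorem dom_mulX {f g : ArithmeticFunction ℂ} {C₁ C₂ : ℝ} {g₁ g₂ : ArithmeticFunction ℝ}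
    (hf : MeanSquareMajorant.Dom (fun n => f n) C₁ g₁)
    (hg : MeanSquareMajorant.Dom (fun n => g n) C₂ g₂) :
    MeanSquareMajorant.Dom (fun n => (f * g) n) (C₁ * C₂) (g₁ * g₂) := by
  intro n hn
  have h := MeanSquareMajorant.dom_seqConv hf hg n hn
  rw [ArithmeticFunction.mul_apply]
  exact h

/-- `|κ(n)| ≤ τ₄(n)` for `n ≥ 1` (local copy). [folklore] -/
private theorem norm_kappaZ_le4X (c' : ℝ) (D : ℕ) {n : ℕ} (hn : n ≠ 0) :
    ‖Skeleton.kappaZ c' D n‖ ≤ MeanSquareMajorant.tau 4 n := by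
  have hI : ∀ b : ℝ, MeanSquareMajorant.Dom (fun n => MeanSquareMajorant.powI b n) 1
      (MeanSquareMajorant.tau 1) := fun b =>
    MeanSquareMajorant.dom_tau_one fun n hn =>
      (MeanSquareMajorant.norm_powI_of_pos b (Nat.pos_of_ne_zero hn)).le
  have hμ : MeanSquareMajorant.Dom
      (fun n => (ArithmeticFunction.moebius : ArithmeticFunction ℂ) n) 1
      (MeanSquareMajorant.tau 1) :=
    MeanSquareMajorant.dom_tau_one fun n _ => norm_moebius_complex_le_one n
  have h := dom_mulX (dom_mulX (dom_mulX (hI (Skeleton.b1 c' D)) (hI (Skeleton.b2 c' D)))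
    (hI (Skeleton.b3 c' D))) hμ
  have h' := h n hn
  have htau : MeanSquareMajorant.tau 1 * MeanSquareMajorant.tau 1 * MeanSquareMajorant.tau 1 *
      MeanSquareMajorant.tau 1 = MeanSquareMajorant.tau 4 := by
    simp only [MeanSquareMajorant.tau]; ring
  rw [htau] at h'
  unfold Skeleton.kappaZ MeanSquareMajorant.kappa
  simpa only [one_mul] using h'

/-- `|(κ∗a)(m)| ≤ B·τ₅(m)` for `|a| ≤ B` (local copy). [folklore] -/
private theorem norm_conv_kappaZ_leX (c' : ℝ) (D : ℕ) {a : ℕ → ℂ} {B : ℝ} (ha : ∀ n, ‖a n‖ ≤ B)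
    (m : ℕ) :
    ‖MeanSquareMajorant.conv (Skeleton.kappaZ c' D) a m‖ ≤ B * MeanSquareMajorant.tau 5 m := by
  rcases Nat.eq_zero_or_pos m with rfl | hm
  · simp [MeanSquareMajorant.conv]
  have hκ : MeanSquareMajorant.Dom (fun n => Skeleton.kappaZ c' D n) 1 (MeanSquareMajorant.tau 4) :=
    fun n hn => by rw [one_mul]; exact norm_kappaZ_le4X c' D hn
  have haD : MeanSquareMajorant.Dom a B (MeanSquareMajorant.tau 1) :=
    MeanSquareMajorant.dom_tau_one fun n _ => ha n
  have h := MeanSquareMajorant.dom_seqConv hκ haD m hm.ne'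
  have htau : MeanSquareMajorant.tau 4 * MeanSquareMajorant.tau 1 = MeanSquareMajorant.tau 5 := by
    simp only [MeanSquareMajorant.tau]; ring
  rw [htau, one_mul] at h
  exact h

/-- `log D ≥ 1` once `D ≥ 3` (local copy). [folklore] -/
private theorem one_le_ellX {D : ℕ} (hD : 3 ≤ D) : 1 ≤ Skeleton.ell D := by
  have hD' : (3 : ℝ) ≤ D := by exact_mod_cast hD
  rw [Skeleton.ell, Real.le_log_iff_exp_le (by linarith)]
  exact le_trans (le_of_lt (lt_trans Real.exp_one_lt_d9 (by norm_num))) hD'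

/-- `1 ≤ P` (local copy). [folklore] -/
private theorem one_le_bigPX (D : ℕ) : 1 ≤ Skeleton.bigP D :=
  Real.one_le_exp (by rw [Skeleton.ell]; positivity)

/-- The X-range facts: from `0 < d`, `0 < h`, `D ≤ R`, `R·dh ≤ PT⁻²` and `D ≥ 3`:
`1 ≤ R`, `R·h ≤ P`, `h·R ≤ P`, `d ≤ P`, `R ≤ P`. [folklore] -/
private theorem xrange_facts {D d h : ℕ} {R : ℝ} (hD3 : 3 ≤ D) (hd : 0 < d) (hh : 0 < h)
    (hDR : (D : ℝ) ≤ R)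
    (hRX : R * ((d * h : ℕ) : ℝ) ≤ Skeleton.bigP D / Skeleton.bigT D ^ 2) :
    1 ≤ R ∧ R * (h : ℝ) ≤ Skeleton.bigP D ∧ (h : ℝ) * R ≤ Skeleton.bigP D ∧
      ((d : ℕ) : ℝ) ≤ Skeleton.bigP D ∧ R ≤ Skeleton.bigP D := by
  have hℓ1 : 1 ≤ Skeleton.ell D := one_le_ellX hD3
  have hℓ0 : 0 < Skeleton.ell D := by linarith
  have hT1 : 1 ≤ Skeleton.bigT D :=
    Real.one_le_exp (Real.rpow_nonneg (le_of_lt hℓ0) _)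
  have hT21 : 1 ≤ Skeleton.bigT D ^ 2 := one_le_pow₀ hT1
  have hP : 0 < Skeleton.bigP D := Real.exp_pos _
  have hPT : Skeleton.bigP D / Skeleton.bigT D ^ 2 ≤ Skeleton.bigP D :=
    div_le_self hP.le hT21
  have hR1 : 1 ≤ R := le_trans (by exact_mod_cast (show 1 ≤ D by omega)) hDR
  have hR0 : 0 < R := by linarith
  have hh1 : (1 : ℝ) ≤ h := by exact_mod_cast hh
  have hd1 : (1 : ℝ) ≤ d := by exact_mod_cast hd
  have hdh : ((d * h : ℕ) : ℝ) = (d : ℝ) * h := by push_cast; ring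
  have hhdh : (h : ℝ) ≤ ((d * h : ℕ) : ℝ) := by rw [hdh]; nlinarith
  have hddh : (d : ℝ) ≤ ((d * h : ℕ) : ℝ) := by rw [hdh]; nlinarith
  have hdh1 : (1 : ℝ) ≤ ((d * h : ℕ) : ℝ) := by rw [hdh]; nlinarith
  have hRh : R * (h : ℝ) ≤ Skeleton.bigP D := by
    have h1 : R * (h : ℝ) ≤ R * ((d * h : ℕ) : ℝ) := by nlinarith
    exact h1.trans (hRX.trans hPT)
  have hdP : ((d : ℕ) : ℝ) ≤ Skeleton.bigP D := by
    have h1 : (d : ℝ) ≤ R * ((d * h : ℕ) : ℝ) := by nlinarith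
    exact h1.trans (hRX.trans hPT)
  have hRP : R ≤ Skeleton.bigP D := by
    have h1 : R ≤ R * ((d * h : ℕ) : ℝ) := by nlinarith
    exact h1.trans (hRX.trans hPT)
  exact ⟨hR1, hRh, by nlinarith [hRh], hdP, hRP⟩

/-- `Re β₃ = 0` (local copy). [cite: Zhang2022LandauSiegel, §2 (2.13)] -/
private theorem beta3_reX (c' : ℝ) (D : ℕ) : (Skeleton.beta3 c' D).re = 0 := by
  rw [beta3_eq_mul_I, Complex.re_ofReal_mul, Complex.I_re, mul_zero]

/-- If `f = Σ' F`, `f* = Σ_{l∈S} F` and `‖F l‖ ≤ g l` off `S` with `g ≥ 0` summable, then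
`‖f − f*‖ ≤ Σ' g` (local copy of the lane's generic tail estimate). [folklore] -/
private theorem norm_sub_le_of_tsumX {f fstar : ℂ} {F : ℕ → ℂ} {g : ℕ → ℝ} (S : Finset ℕ)
    (hf : f = ∑' l, F l) (hfstar : fstar = ∑ l ∈ S, F l) (hg : Summable g)
    (hg0 : ∀ l, 0 ≤ g l) (hFg : ∀ l, l ∉ S → ‖F l‖ ≤ g l) : ‖f - fstar‖ ≤ ∑' l, g l := by
  classical
  set U : ℕ → ℂ := fun l => if l ∈ S then 0 else F l with hU
  set V : ℕ → ℂ := fun l => if l ∈ S then F l else 0 with hV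
  have hUg : ∀ l, ‖U l‖ ≤ g l := fun l => by
    by_cases hl : l ∈ S
    · simp only [hU, if_pos hl, norm_zero]; exact hg0 l
    · simp only [hU, if_neg hl]; exact hFg l hl
  have hUs : Summable U := Summable.of_norm_bounded hg hUg
  have hVs : Summable V :=
    summable_of_ne_finset_zero (s := S) (fun l hl => by simp only [hV, if_neg hl])
  have hVsum : ∑' l, V l = ∑ l ∈ S, F l := by
    rw [tsum_eq_sum (s := S) (fun l hl => by simp only [hV, if_neg hl])]
    exact Finset.sum_congr rfl fun l hl => by simp only [hV, if_pos hl]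
  have htsum : ∑' l, F l = ∑' l, (V l + U l) :=
    tsum_congr fun l => by by_cases hl : l ∈ S <;> simp [hU, hV, hl]
  rw [hf, hfstar, htsum, hVs.tsum_add hUs, hVsum, add_sub_cancel_left]
  exact tsum_of_norm_bounded hg.hasSum hUg

/-- `log⌊4Pt₀·Rh⌋ ≤ 524𝓛⁹` on the X-range (`Rh ≤ P`; cf. the lane's printed-range version with
`Rh ≤ P₁`). [folklore] -/
private theorem log_len_leX {D : ℕ} (hD : 3 ≤ D) {R : ℝ} {h : ℕ}
    (hRh : R * h ≤ Skeleton.bigP D) {N : ℕ} (hN1 : 1 ≤ N)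
    (hNle : (N : ℝ) ≤ 4 * Skeleton.bigP D * Skeleton.t0 D * (R * h)) :
    Real.log N ≤ 524 * Skeleton.ell D ^ 9 := by
  have hℓ1 := one_le_ellX hD
  have hP1 := one_le_bigPX D
  have hP0 : 0 < Skeleton.bigP D := by linarith
  have hT : Skeleton.t0 D = Skeleton.ell D ^ 519 := rfl
  have hT1 : 1 ≤ Skeleton.t0 D := by rw [hT]; exact one_le_pow₀ hℓ1
  have hN0 : (0 : ℝ) < N := by exact_mod_cast hN1
  have h4L : (N : ℝ) ≤ 4 * Skeleton.bigP D * Skeleton.t0 D * Skeleton.bigP D :=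
    hNle.trans (by gcongr)
  have hlog4 : Real.log 4 ≤ 3 := by
    have := Real.log_le_sub_one_of_pos (show (0:ℝ) < 4 by norm_num); linarith
  have hlogP : Real.log (Skeleton.bigP D) = Skeleton.ell D ^ 9 := by
    rw [Skeleton.bigP, Real.log_exp]
  have hlogT : Real.log (Skeleton.t0 D) ≤ 519 * Skeleton.ell D := by
    rw [hT, Real.log_pow]
    have := Real.log_le_sub_one_of_pos (show 0 < Skeleton.ell D by linarith)
    push_cast; nlinarith
  have hℓ9 : Skeleton.ell D ≤ Skeleton.ell D ^ 9 := le_self_pow₀ hℓ1 (by norm_num)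
  have h19 : 1 ≤ Skeleton.ell D ^ 9 := one_le_pow₀ hℓ1
  calc Real.log N ≤ Real.log (4 * Skeleton.bigP D * Skeleton.t0 D * Skeleton.bigP D) :=
        Real.log_le_log hN0 h4L
    _ = Real.log 4 + Real.log (Skeleton.bigP D) + Real.log (Skeleton.t0 D) +
          Real.log (Skeleton.bigP D) := by
        rw [Real.log_mul (by positivity) hP0.ne', Real.log_mul (by positivity) (by positivity),
          Real.log_mul (by norm_num) hP0.ne']
    _ ≤ 3 + Skeleton.ell D ^ 9 + 519 * Skeleton.ell D + Skeleton.ell D ^ 9 := by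
        rw [hlogP]; linarith
    _ ≤ 524 * Skeleton.ell D ^ 9 := by nlinarith

/-! ## The large-sieve bound `§7.u039` on the X-range -/

set_option maxHeartbeats 800000 in
/-- **`§7.u039` on the X-range** (`D ≤ R`, `R·dh ≤ PT⁻²`; the printed range `R < (dh)⁻¹P₁` is NOT
assumed): for `σ = 1` and all real `t`,
`Σ_{R≤r<2R} Σ*_{θ mod r} |Σ_{l∈𝔌(Rh),(l,h)=1} (κ∗a₁)(dl)θ(l)l^{−s}|² ≤ C τ₅(d)² 𝓛²²⁵ (R² + PRht₀)(PRht₀)⁻¹`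
and `(R² + PRht₀)(PRht₀)⁻¹ ≤ C` — the landed `step7u039_holds` verbatim, with its two
printed-range facts (`Rh ≤ P₁`, `R ≤ P`) replaced by `Rh ≤ R·dh ≤ PT⁻² ≤ P`; same constants.
[cite: Zhang2022LandauSiegel, §7 p.39, tex L2047] -/
theorem step7u039X (c' : ℝ) (B : ℝ) :
    ∃ k : ℕ, ∃ C : ℝ, Skeleton.ForAllLarge fun D _ χ => Skeleton.AssumptionA D χ →
      ∀ a₁ : ℕ → ℂ, Skeleton.Adm72 D B a₁ → ∀ (d h : ℕ) (R : ℝ), 0 < d → 0 < h →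
        (D : ℝ) ≤ R → R * ((d * h : ℕ) : ℝ) ≤ Skeleton.bigP D / Skeleton.bigT D ^ 2 → ∀ t : ℝ,
          (∑ r ∈ dyadic R, ∑ θ : DirichletCharacter ℂ r,
              (if θ.IsPrimitive then ‖lPoly c' D a₁ R r h d θ (1 + t * I)‖ ^ 2 else 0) ≤
            C * MeanSquareMajorant.tau 5 d ^ 2 * Skeleton.ell D ^ k *
              ((R ^ 2 + Skeleton.bigP D * R * h * Skeleton.t0 D) /
                (Skeleton.bigP D * R * h * Skeleton.t0 D))) ∧
          (R ^ 2 + Skeleton.bigP D * R * h * Skeleton.t0 D) /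
              (Skeleton.bigP D * R * h * Skeleton.t0 D) ≤ C := by
  set K := MeanSquareMajorant.majorantConst 25 10 with hK
  have hK0 : 0 < K := MeanSquareMajorant.majorantConst_pos _ _
  refine ⟨225, 57 * B ^ 2 * K * 524 ^ 25 + 2, 3, fun D _ χ hD _ _ _ a₁ ha₁ d h R hd hh hDR hRX
    t => ?_⟩
  have hD3 : 3 ≤ D := hD
  obtain ⟨hR1, hRh', hhR', hdP, hRP'⟩ := xrange_facts hD3 hd hh hDR hRX
  -- the quantities
  set P := Skeleton.bigP D with hPdef
  set ℓ := Skeleton.ell D with hℓ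
  set T₀ := Skeleton.t0 D with hT₀
  set L := P * R * (h : ℝ) * T₀ with hLdef
  set τd := MeanSquareMajorant.tau 5 d with hτd
  have hP1 : 1 ≤ P := one_le_bigPX D
  have hℓ1 : 1 ≤ ℓ := one_le_ellX hD3
  have hT1 : 1 ≤ T₀ := by rw [hT₀, Skeleton.t0]; exact one_le_pow₀ hℓ1
  have hD1 : (1 : ℝ) ≤ D := by exact_mod_cast (show 1 ≤ D by omega)
  have hR0 : 0 ≤ R := by linarith
  have hh1 : (1 : ℝ) ≤ h := by exact_mod_cast hh
  have hL1 : 1 ≤ L := by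
    have h1 : (1 : ℝ) ≤ P * R := one_le_mul_of_one_le_of_one_le hP1 hR1
    have h2 : (1 : ℝ) ≤ P * R * h := one_le_mul_of_one_le_of_one_le h1 hh1
    exact one_le_mul_of_one_le_of_one_le h2 hT1
  have hL0 : 0 < L := by linarith
  have hB0 : 0 ≤ B := (norm_nonneg _).trans (ha₁.1 0)
  have hRh : R * (h : ℝ) ≤ P := hRh'
  -- the large sieve data
  set S := (natI D (R * h)).filter (fun l => Nat.Coprime l h) with hS
  set N : ℕ := ⌊4 * Skeleton.bigP D * Skeleton.t0 D * (R * h)⌋₊ with hN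
  set Q : ℕ := ⌈2 * R⌉₊ with hQ
  set s : ℂ := 1 + t * I with hs
  set b : ℕ → ℂ := fun l =>
    if l ∈ S then MeanSquareMajorant.conv (Skeleton.kappaZ c' D) a₁ (d * l) * (l : ℂ) ^ (-s) else 0
    with hb
  have hSsub : S ⊆ Finset.Ioc 0 N := by
    intro l hl
    have hl2 := Finset.mem_filter.mp (Finset.mem_filter.mp hl).1
    refine Finset.mem_Ioc.mpr ⟨hl2.2.1, ?_⟩
    have := Finset.mem_range.mp hl2.1
    omega
  have hM : dyadic R ⊆ Finset.Icc 1 Q := by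
    intro r hr
    obtain ⟨hRr, _⟩ := (Finset.mem_filter.mp hr).2
    have h1 : (1 : ℝ) ≤ r := le_trans hR1 hRr
    have hrQ : r < Q := Finset.mem_range.mp (Finset.mem_filter.mp hr).1
    exact Finset.mem_Icc.mpr ⟨by exact_mod_cast h1, hrQ.le⟩
  have hLS := largeSieve_meanValue (dyadic R) N Q hM b
  -- the left side is the large-sieve form
  have hlhs : (∑ r ∈ dyadic R, ∑ θ : DirichletCharacter ℂ r,
        (if θ.IsPrimitive then ‖lPoly c' D a₁ R r h d θ s‖ ^ 2 else 0)) =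
      ∑ r ∈ dyadic R, ∑ θ : DirichletCharacter ℂ r with θ.IsPrimitive,
        ‖∑ n ∈ Finset.Ioc 0 N, b n * θ n‖ ^ 2 := by
    refine Finset.sum_congr rfl fun r _ => ?_
    rw [Finset.sum_filter]
    refine Finset.sum_congr rfl fun θ _ => ?_
    split_ifs with hθ
    · congr 2
      rw [lPoly]
      have hsum : ∑ n ∈ Finset.Ioc 0 N, b n * θ n =
          ∑ n ∈ Finset.Ioc 0 N, (if n ∈ S then
            MeanSquareMajorant.conv (Skeleton.kappaZ c' D) a₁ (d * n) * (n : ℂ) ^ (-s) * θ n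
            else 0) := by
        refine Finset.sum_congr rfl fun n _ => ?_
        simp only [hb]
        split_ifs <;> simp
      rw [hsum, Finset.sum_ite_mem, Finset.inter_eq_right.mpr hSsub]
      exact Finset.sum_congr rfl fun l _ => by ring
    · rfl
  -- the coefficients: `‖b(n)‖² ≤ B²τ₅(d)²(3/L)·τ₅(n)²/n` on `S`
  have hcoef : ∀ n ∈ S, ‖b n‖ ^ 2 ≤ B ^ 2 * τd ^ 2 * (3 / L) *
      (MeanSquareMajorant.tau 5 n ^ 2 / n) := by
    intro n hn
    have hnI := (Finset.mem_filter.mp (Finset.mem_filter.mp hn).1).2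
    have hn0 : 0 < n := hnI.1
    have hn' : (0 : ℝ) < n := by exact_mod_cast hn0
    have hnL : L ≤ 3 * n := by
      have h1 : 1 / 3 * Skeleton.bigP D * Skeleton.t0 D * (R * h) ≤ n := hnI.2.1
      have : L = 3 * (1 / 3 * Skeleton.bigP D * Skeleton.t0 D * (R * h)) := by
        rw [hLdef]; ring
      linarith
    simp only [hb, if_pos hn]
    rw [norm_mul, mul_pow, Complex.norm_natCast_cpow_of_pos hn0]
    have hre : (-s).re = -1 := by simp [hs]
    rw [hre, Real.rpow_neg_one]
    have h1 : ‖MeanSquareMajorant.conv (Skeleton.kappaZ c' D) a₁ (d * n)‖ ≤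
        B * (τd * MeanSquareMajorant.tau 5 n) :=
      (norm_conv_kappaZ_leX c' D ha₁.1 (d * n)).trans
        (mul_le_mul_of_nonneg_left (tau_mul_leX 5 d n) hB0)
    have h2 : ‖MeanSquareMajorant.conv (Skeleton.kappaZ c' D) a₁ (d * n)‖ ^ 2 ≤
        (B * (τd * MeanSquareMajorant.tau 5 n)) ^ 2 := pow_le_pow_left₀ (norm_nonneg _) h1 2
    have h3 : ((n : ℝ)⁻¹) ^ 2 ≤ (3 / L) * (1 / n) := by
      rw [inv_pow, ← one_div, div_mul_div_comm, mul_one,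
        div_le_div_iff₀ (by positivity) (by positivity)]
      nlinarith
    calc ‖MeanSquareMajorant.conv (Skeleton.kappaZ c' D) a₁ (d * n)‖ ^ 2 * ((n : ℝ)⁻¹) ^ 2
        ≤ (B * (τd * MeanSquareMajorant.tau 5 n)) ^ 2 * ((3 / L) * (1 / n)) :=
          mul_le_mul h2 h3 (by positivity) (by positivity)
      _ = B ^ 2 * τd ^ 2 * (3 / L) * (MeanSquareMajorant.tau 5 n ^ 2 / n) := by ring
  -- the coefficient sum
  have hN2 : 2 ≤ N := by
    rw [hN]
    apply Nat.le_floor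
    push_cast
    have : (1:ℝ) ≤ R * h := one_le_mul_of_one_le_of_one_le hR1 hh1
    nlinarith [hP1, hT1, this]
  have hN1 : (1 : ℝ) ≤ N := by exact_mod_cast le_trans (by norm_num) hN2
  have hsumb : ∑ n ∈ Finset.Ioc 0 N, ‖b n‖ ^ 2 ≤
      B ^ 2 * τd ^ 2 * (3 / L) * (K * Real.log N ^ 25) := by
    have hzero : ∀ n ∈ Finset.Ioc 0 N, n ∉ S → ‖b n‖ ^ 2 = 0 := fun n _ hn => by simp [hb, hn]
    have htauSum : ∑ n ∈ Finset.Icc 1 N, MeanSquareMajorant.tau 5 n ^ 2 / n ≤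
        K * Real.log N ^ 25 := by
      have := MeanSquareMajorant.sum_tau_sq_div_le 5 hN2
      norm_num at this
      rw [hK]; exact this
    calc ∑ n ∈ Finset.Ioc 0 N, ‖b n‖ ^ 2 = ∑ n ∈ S, ‖b n‖ ^ 2 :=
          (Finset.sum_subset hSsub hzero).symm
      _ ≤ ∑ n ∈ S, B ^ 2 * τd ^ 2 * (3 / L) * (MeanSquareMajorant.tau 5 n ^ 2 / n) :=
          Finset.sum_le_sum hcoef
      _ = B ^ 2 * τd ^ 2 * (3 / L) * ∑ n ∈ S, MeanSquareMajorant.tau 5 n ^ 2 / n := by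
          rw [Finset.mul_sum]
      _ ≤ B ^ 2 * τd ^ 2 * (3 / L) * ∑ n ∈ Finset.Icc 1 N, MeanSquareMajorant.tau 5 n ^ 2 / n := by
          apply mul_le_mul_of_nonneg_left _ (by positivity)
          apply Finset.sum_le_sum_of_subset_of_nonneg
          · intro n hn
            have := Finset.mem_Ioc.mp (hSsub hn)
            exact Finset.mem_Icc.mpr ⟨this.1, this.2⟩
          · intro n _ _
            exact div_nonneg (sq_nonneg _) (Nat.cast_nonneg _)
      _ ≤ B ^ 2 * τd ^ 2 * (3 / L) * (K * Real.log N ^ 25) :=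
          mul_le_mul_of_nonneg_left htauSum (by positivity)
  -- sizes of `N`, `Q`, `log N`
  have hNle : (N : ℝ) ≤ 4 * Skeleton.bigP D * Skeleton.t0 D * (R * h) :=
    Nat.floor_le (by positivity)
  have hNL : (N : ℝ) ≤ 4 * L := by rw [hLdef]; linarith [hNle]
  have hQle : (Q : ℝ) ≤ 3 * R := by
    calc (Q : ℝ) ≤ 2 * R + 1 := (Nat.ceil_lt_add_one (by linarith)).le
      _ ≤ 3 * R := by linarith
  have hQsq : (Q : ℝ) ^ 2 ≤ (3 * R) ^ 2 := by gcongr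
  have hfac : (N : ℝ) + 1 + 2 * (Q : ℝ) ^ 2 ≤ 19 * (R ^ 2 + L) := by nlinarith
  have hlogN : Real.log N ≤ 524 * ℓ ^ 9 :=
    log_len_leX hD3 hRh (by exact_mod_cast le_trans (by norm_num) hN2) hNle
  have hlog25 : Real.log N ^ 25 ≤ 524 ^ 25 * ℓ ^ 225 := by
    calc Real.log N ^ 25 ≤ (524 * ℓ ^ 9) ^ 25 :=
          pow_le_pow_left₀ (Real.log_nonneg hN1) hlogN 25
      _ = 524 ^ 25 * ℓ ^ 225 := by ring
  -- assemble
  set A : ℝ := 524 ^ 25 with hA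
  have hA0 : 0 < A := by rw [hA]; positivity
  have hX0 : 0 ≤ τd ^ 2 * ℓ ^ 225 * ((R ^ 2 + L) / L) := by positivity
  refine ⟨?_, ?_⟩
  · have step1 : (∑ r ∈ dyadic R, ∑ θ : DirichletCharacter ℂ r,
          (if θ.IsPrimitive then ‖lPoly c' D a₁ R r h d θ s‖ ^ 2 else 0)) ≤
        (19 * (R ^ 2 + L)) * (B ^ 2 * τd ^ 2 * (3 / L) * (K * (A * ℓ ^ 225))) := by
      calc (∑ r ∈ dyadic R, ∑ θ : DirichletCharacter ℂ r,
            (if θ.IsPrimitive then ‖lPoly c' D a₁ R r h d θ s‖ ^ 2 else 0))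
          = ∑ r ∈ dyadic R, ∑ θ : DirichletCharacter ℂ r with θ.IsPrimitive,
              ‖∑ n ∈ Finset.Ioc 0 N, b n * θ n‖ ^ 2 := hlhs
        _ ≤ ((N : ℝ) + 1 + 2 * (Q : ℝ) ^ 2) * ∑ n ∈ Finset.Ioc 0 N, ‖b n‖ ^ 2 := hLS
        _ ≤ (19 * (R ^ 2 + L)) * (B ^ 2 * τd ^ 2 * (3 / L) * (K * Real.log N ^ 25)) :=
            mul_le_mul hfac hsumb (Finset.sum_nonneg fun _ _ => by positivity) (by positivity)
        _ ≤ (19 * (R ^ 2 + L)) * (B ^ 2 * τd ^ 2 * (3 / L) * (K * (A * ℓ ^ 225))) := by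
            apply mul_le_mul_of_nonneg_left _ (by positivity)
            apply mul_le_mul_of_nonneg_left _ (by positivity)
            exact mul_le_mul_of_nonneg_left hlog25 hK0.le
    have step2 : (19 * (R ^ 2 + L)) * (B ^ 2 * τd ^ 2 * (3 / L) * (K * (A * ℓ ^ 225))) =
        (57 * B ^ 2 * K * A) * (τd ^ 2 * ℓ ^ 225 * ((R ^ 2 + L) / L)) := by
      rw [div_eq_mul_inv, div_eq_mul_inv]
      ring
    have step3 : (57 * B ^ 2 * K * A) * (τd ^ 2 * ℓ ^ 225 * ((R ^ 2 + L) / L)) ≤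
        (57 * B ^ 2 * K * A + 2) * (τd ^ 2 * ℓ ^ 225 * ((R ^ 2 + L) / L)) :=
      mul_le_mul_of_nonneg_right (by linarith only []) hX0
    calc (∑ r ∈ dyadic R, ∑ θ : DirichletCharacter ℂ r,
          (if θ.IsPrimitive then ‖lPoly c' D a₁ R r h d θ s‖ ^ 2 else 0))
        ≤ _ := step1
      _ = _ := step2
      _ ≤ _ := step3
      _ = (57 * B ^ 2 * K * A + 2) * τd ^ 2 * ℓ ^ 225 * ((R ^ 2 + L) / L) := by ring
  · have hRL : R ^ 2 ≤ L := by
      have h1 : R ≤ P * (h : ℝ) * T₀ := by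
        calc R ≤ P := hRP'
          _ ≤ P * h := le_mul_of_one_le_right (by linarith only [hP1]) hh1
          _ ≤ P * h * T₀ := le_mul_of_one_le_right (by positivity) hT1
      have hR0' : 0 < R := by linarith
      calc R ^ 2 = R * R := sq R
        _ ≤ (P * h * T₀) * R := mul_le_mul_of_nonneg_right h1 hR0'.le
        _ = L := by rw [hLdef]; ring
    have h2 : (R ^ 2 + L) / L ≤ 2 := by
      rw [div_le_iff₀ hL0]; linarith only [hRL]
    have h3 : (2 : ℝ) ≤ 57 * B ^ 2 * K * A + 2 := by
      have : 0 ≤ 57 * B ^ 2 * K * A := by positivity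
      linarith only [this]
    exact h2.trans h3

/-! ## The `𝔌(Rh)`-localisation `𝔰 ↦ 𝔰*` on the X-range -/

set_option maxHeartbeats 800000 in
/-- **`§7.u037` on the X-range** (`D ≤ R`, `R·dh ≤ PT⁻²`): there is `c > 0` with
`|𝔰(r,h,d;θ) − 𝔰*(R,r,h,d;θ)| ≤ exp(−c𝓛¹⁰)` for all large `D`, `𝐚₁` admissible, `R ≤ r < 2R`
and every `θ (mod r)` — the landed `Section7TruncI.step7bTruncI_holds` verbatim (far-region
bound of Lemma 5.3 + `l⁻²`-majorant), with its printed-range facts `d ≤ P`, `hR ≤ P` re-derived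
from `R·dh ≤ PT⁻² ≤ P`. [cite: Zhang2022LandauSiegel, §7 p.38 tex L2036; §5 Lemma 5.3] -/
theorem step7bTruncIX (c' : ℝ) (B : ℝ) :
    ∃ c : ℝ, 0 < c ∧ Skeleton.ForAllLarge fun D _ χ => Skeleton.AssumptionA D χ →
      ∀ a₁ : ℕ → ℂ, Skeleton.Adm72 D B a₁ → ∀ (d h : ℕ) (R : ℝ), 0 < d → 0 < h →
        (D : ℝ) ≤ R → R * ((d * h : ℕ) : ℝ) ≤ Skeleton.bigP D / Skeleton.bigT D ^ 2 →
        ∀ r ∈ dyadic R, ∀ θ : DirichletCharacter ℂ r,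
          ‖frakS c' D a₁ r h d θ - frakSstar c' D a₁ R r h d θ‖ ≤
            Real.exp (-c * Skeleton.ell D ^ 10) := by
  classical
  obtain ⟨c₀, hc₀, D₁, hfar⟩ := DeltaFar.norm_DeltaW_le_of_far
  have hZsum : Summable (fun l : ℕ => ((l : ℝ) ^ 2)⁻¹) :=
    Real.summable_nat_pow_inv.mpr one_lt_two
  set Z : ℝ := ∑' l : ℕ, ((l : ℝ) ^ 2)⁻¹ with hZ
  have hZ0 : 0 ≤ Z := tsum_nonneg fun l => by positivity
  set B₀ : ℝ := max B 0 with hB₀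
  have hB₀0 : 0 ≤ B₀ := le_max_right _ _
  have hBB₀ : B ≤ B₀ := le_max_left _ _
  set K : ℝ := 12288 * B₀ * Z with hK
  have hK0 : 0 ≤ K := by positivity
  set M : ℝ := max 2 (2 / c₀ * (17 + Real.log (K + 1))) with hM
  obtain ⟨D₂, hD₂⟩ := Skeleton.exists_nat_forall_le_ell M
  refine ⟨c₀ / 2, by positivity, max D₁ (max D₂ 3), ?_⟩
  intro D _ χ hD hq hprim _hA a₁ ha d h R hd hh hDR hRX r hr θ
  have hD₁ : D₁ ≤ D := le_trans (le_max_left _ _) hD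
  have hD₂' : D₂ ≤ D := le_trans ((le_max_left _ _).trans (le_max_right _ _)) hD
  have hD3 : 3 ≤ D := le_trans ((le_max_right _ _).trans (le_max_right _ _)) hD
  have hMℓ : M ≤ Skeleton.ell D := hD₂ D hD₂'
  have hℓ2 : 2 ≤ Skeleton.ell D := le_trans (le_max_left _ _) hMℓ
  have hℓM : 2 / c₀ * (17 + Real.log (K + 1)) ≤ Skeleton.ell D := le_trans (le_max_right _ _) hMℓ
  have hℓ1 : 1 ≤ Skeleton.ell D := by linarith
  have hℓ0 : 0 < Skeleton.ell D := by linarith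
  have hfarD := hfar D χ hD₁ hq hprim
  obtain ⟨ha1, -⟩ := ha
  have hB0 : 0 ≤ B := (norm_nonneg _).trans (ha1 0)
  obtain ⟨hR1, -, hhR_le, hd_le, -⟩ := xrange_facts hD3 hd hh hDR hRX
  have hR0 : 0 < R := by linarith
  obtain ⟨hrR, hr2⟩ := (Finset.mem_filter.mp hr).2
  have hh0 : (0 : ℝ) < h := Nat.cast_pos.mpr hh
  have hd0 : (0 : ℝ) < d := Nat.cast_pos.mpr hd
  have hr0 : (0 : ℝ) < r := lt_of_lt_of_le hR0 hrR
  have hP : 0 < bigP D := bigP_pos D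
  have hP1 : 1 ≤ bigP D := one_le_bigPX D
  -- the parameters of the majorant
  set ε : ℝ := Real.exp (-c₀ * Skeleton.ell D ^ 10) with hε
  have hε0 : 0 < ε := Real.exp_pos _
  set W : ℝ := 4 * bigP D * h * R with hW
  have hW0 : 0 ≤ W := by positivity
  have hW_le : W ≤ 4 * bigP D ^ 2 := by
    calc W = 4 * bigP D * ((h : ℝ) * R) := by rw [hW]; ring
      _ ≤ 4 * bigP D * bigP D := mul_le_mul_of_nonneg_left hhR_le (by positivity)
      _ = 4 * bigP D ^ 2 := by ring
  set A : ℝ := B * (d : ℝ) ^ 4 * (3 * bigP D) * W ^ 6 * ε with hA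
  have hA0 : 0 ≤ A :=
    mul_nonneg (mul_nonneg (mul_nonneg (mul_nonneg hB0 (pow_nonneg hd0.le 4)) (by positivity))
      (pow_nonneg hW0 6)) hε0.le
  set S : Finset ℕ := natI D (R * h) with hS
  -- reduce to the termwise bound off `S`
  have hgsum : Summable (fun l : ℕ => A * ((l : ℝ) ^ 2)⁻¹) := hZsum.mul_left A
  have hg0 : ∀ l : ℕ, 0 ≤ A * ((l : ℝ) ^ 2)⁻¹ := fun l => by positivity
  refine (norm_sub_le_of_tsumX S
    (F := fun l => if Nat.Coprime l h then
      MeanSquareMajorant.conv (Skeleton.kappaZ c' D) a₁ (d * l) * θ (l : ZMod r) *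
        ∑ p ∈ Skeleton.primeWindow D, (p : ℂ) ^ Skeleton.beta3 c' D * θ⁻¹ (p : ZMod r) *
          Skeleton.DeltaW D ((l : ℝ) / ((p : ℝ) * h * r))
      else 0)
    rfl ?_ hgsum hg0 ?_).trans ?_
  · -- `𝔰* = Σ_{l ∈ S} F l`
    rw [frakSstar, Finset.sum_filter]
    refine Finset.sum_congr rfl fun l _ => ?_
    split_ifs with hc
    · congr 1
      exact Finset.sum_congr rfl fun p _ => by ring
    · rfl
  · -- termwise bound off `S`
    intro l hlS'
    rcases Nat.eq_zero_or_pos l with rfl | hl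
    · have h0 : MeanSquareMajorant.conv (Skeleton.kappaZ c' D) a₁ 0 = 0 := by
        have := Section7TailP2.norm_conv_kappa_le c' D ha1 (d * 0)
        rw [mul_zero, Nat.divisors_zero, Finset.card_empty] at this
        simpa using this
      simp [h0]
    by_cases hc : Nat.Coprime l h
    swap
    · rw [if_neg hc, norm_zero]; exact hg0 l
    rw [if_pos hc]
    have hl0 : (0 : ℝ) < l := Nat.cast_pos.mpr hl
    -- the coefficient
    have hconv : ‖MeanSquareMajorant.conv (Skeleton.kappaZ c' D) a₁ (d * l)‖ ≤
        B * ((d * l : ℕ) : ℝ) ^ 4 :=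
      (Section7TailP2.norm_conv_kappa_le c' D ha1 (d * l)).trans
        (mul_le_mul_of_nonneg_left (pow_le_pow_left₀ (Nat.cast_nonneg _)
          (by exact_mod_cast Nat.card_divisors_le_self (d * l)) 4) hB0)
    -- the `p`-sum
    have hinner : ‖∑ p ∈ Skeleton.primeWindow D, (p : ℂ) ^ Skeleton.beta3 c' D *
        θ⁻¹ (p : ZMod r) * Skeleton.DeltaW D ((l : ℝ) / ((p : ℝ) * h * r))‖ ≤
        3 * bigP D * (ε * (W / l) ^ 6) := by
      calc ‖∑ p ∈ Skeleton.primeWindow D, (p : ℂ) ^ Skeleton.beta3 c' D * θ⁻¹ (p : ZMod r) *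
              Skeleton.DeltaW D ((l : ℝ) / ((p : ℝ) * h * r))‖
          ≤ ∑ p ∈ Skeleton.primeWindow D, ‖(p : ℂ) ^ Skeleton.beta3 c' D * θ⁻¹ (p : ZMod r) *
              Skeleton.DeltaW D ((l : ℝ) / ((p : ℝ) * h * r))‖ := norm_sum_le _ _
        _ ≤ ∑ p ∈ Skeleton.primeWindow D, ε * (W / l) ^ 6 := by
            refine Finset.sum_le_sum fun p hp => ?_
            have hp0 : (0 : ℝ) < p := pos_of_mem_primeWindow hp
            have hQ0 : 0 < (p : ℝ) * h * r := by positivity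
            have hx0 : 0 < (l : ℝ) / ((p : ℝ) * h * r) := div_pos hl0 hQ0
            have hΔ := hfarD ((l : ℝ) / ((p : ℝ) * h * r)) hx0
              (Section7TruncI.far_of_not_mem_natI hℓ2 hR0 hh hrR hr2 hp hl hlS')
            have hQW : (p : ℝ) * h * r ≤ W := by
              calc (p : ℝ) * h * r ≤ 2 * bigP D * h * (2 * R) :=
                    mul_le_mul (mul_le_mul_of_nonneg_right
                      (le_two_mul_bigP_of_mem_primeWindow hℓ1 hp) hh0.le) hr2.le hr0.le
                      (by positivity)
                _ = W := by rw [hW]; ring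
            have hx6 : ((((l : ℝ) / ((p : ℝ) * h * r)) ^ 6)⁻¹) ≤ (W / l) ^ 6 := by
              rw [← inv_pow, inv_div]
              exact pow_le_pow_left₀ (div_nonneg hQ0.le hl0.le)
                (div_le_div_of_nonneg_right hQW hl0.le) 6
            rw [norm_mul, norm_mul,
              Complex.norm_natCast_cpow_of_pos (prime_of_mem_primeWindow' hp).pos,
              beta3_reX, Real.rpow_zero, one_mul]
            calc ‖θ⁻¹ (p : ZMod r)‖ * ‖Skeleton.DeltaW D ((l : ℝ) / ((p : ℝ) * h * r))‖
                ≤ 1 * (ε * ((((l : ℝ) / ((p : ℝ) * h * r)) ^ 6)⁻¹)) :=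
                  mul_le_mul (DirichletCharacter.norm_le_one _ _) hΔ (norm_nonneg _) zero_le_one
              _ ≤ ε * (W / l) ^ 6 := by
                  rw [one_mul]; exact mul_le_mul_of_nonneg_left hx6 hε0.le
        _ = ((Skeleton.primeWindow D).card : ℝ) * (ε * (W / l) ^ 6) := by
            rw [Finset.sum_const, nsmul_eq_mul]
        _ ≤ 3 * bigP D * (ε * (W / l) ^ 6) :=
            mul_le_mul_of_nonneg_right (Section7TailP2.card_primeWindow_le hℓ1) (by positivity)
    have hBdl : 0 ≤ B * ((d * l : ℕ) : ℝ) ^ 4 := mul_nonneg hB0 (pow_nonneg (Nat.cast_nonneg _) 4)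
    calc ‖MeanSquareMajorant.conv (Skeleton.kappaZ c' D) a₁ (d * l) * θ (l : ZMod r) *
            ∑ p ∈ Skeleton.primeWindow D, (p : ℂ) ^ Skeleton.beta3 c' D * θ⁻¹ (p : ZMod r) *
              Skeleton.DeltaW D ((l : ℝ) / ((p : ℝ) * h * r))‖
        = ‖MeanSquareMajorant.conv (Skeleton.kappaZ c' D) a₁ (d * l)‖ * ‖θ (l : ZMod r)‖ *
            ‖∑ p ∈ Skeleton.primeWindow D, (p : ℂ) ^ Skeleton.beta3 c' D * θ⁻¹ (p : ZMod r) *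
              Skeleton.DeltaW D ((l : ℝ) / ((p : ℝ) * h * r))‖ := by rw [norm_mul, norm_mul]
      _ ≤ B * ((d * l : ℕ) : ℝ) ^ 4 * 1 * (3 * bigP D * (ε * (W / l) ^ 6)) :=
          mul_le_mul (mul_le_mul hconv (DirichletCharacter.norm_le_one _ _) (norm_nonneg _) hBdl)
            hinner (norm_nonneg _) (by rw [mul_one]; exact hBdl)
      _ = A * ((l : ℝ) ^ 2)⁻¹ := by
          rw [hA]
          have hl0' : (l : ℝ) ≠ 0 := hl0.ne'
          push_cast
          field_simp
          try ring
  -- `Σ' g = A·Z ≤ exp(−(c₀/2)𝓛¹⁰)`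
  rw [tsum_mul_left, ← hZ]
  have hA_le : A ≤ 12288 * B₀ * bigP D ^ 17 * ε := by
    have h1 : (d : ℝ) ^ 4 ≤ bigP D ^ 4 := pow_le_pow_left₀ hd0.le hd_le 4
    have h2 : W ^ 6 ≤ (4 * bigP D ^ 2) ^ 6 := pow_le_pow_left₀ hW0 hW_le 6
    have h3 : B * (d : ℝ) ^ 4 ≤ B₀ * bigP D ^ 4 := mul_le_mul hBB₀ h1 (by positivity) hB₀0
    calc A = B * (d : ℝ) ^ 4 * (3 * bigP D) * W ^ 6 * ε := rfl
      _ ≤ B₀ * bigP D ^ 4 * (3 * bigP D) * (4 * bigP D ^ 2) ^ 6 * ε := by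
          apply mul_le_mul_of_nonneg_right _ hε0.le
          exact mul_le_mul (mul_le_mul_of_nonneg_right h3 (by positivity)) h2
            (pow_nonneg hW0 6) (by positivity)
      _ = 12288 * B₀ * bigP D ^ 17 * ε := by ring
  have hP17 : bigP D ^ 17 = Real.exp (17 * Skeleton.ell D ^ 9) := by
    rw [bigP, ← Real.exp_nat_mul]; norm_num
  have hK1 : 0 < K + 1 := by linarith
  have hKexp : K ≤ Real.exp (Real.log (K + 1)) := by
    rw [Real.exp_log hK1]; linarith
  have hlogK : 0 ≤ Real.log (K + 1) := Real.log_nonneg (by linarith)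
  have hℓ9 : 1 ≤ Skeleton.ell D ^ 9 := one_le_pow₀ hℓ1
  have h1 : 17 + Real.log (K + 1) ≤ c₀ / 2 * Skeleton.ell D := by
    have h := mul_le_mul_of_nonneg_left hℓM (by positivity : (0 : ℝ) ≤ c₀ / 2)
    have e2 : c₀ / 2 * (2 / c₀ * (17 + Real.log (K + 1))) = 17 + Real.log (K + 1) := by
      field_simp
    linarith [e2]
  have h2 : Real.log (K + 1) + 17 * Skeleton.ell D ^ 9 ≤ c₀ / 2 * Skeleton.ell D ^ 10 := by
    calc Real.log (K + 1) + 17 * Skeleton.ell D ^ 9 ≤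
          (17 + Real.log (K + 1)) * Skeleton.ell D ^ 9 := by nlinarith
      _ ≤ c₀ / 2 * Skeleton.ell D * Skeleton.ell D ^ 9 :=
          mul_le_mul_of_nonneg_right h1 (by positivity)
      _ = c₀ / 2 * Skeleton.ell D ^ 10 := by ring
  calc A * Z ≤ 12288 * B₀ * bigP D ^ 17 * ε * Z := mul_le_mul_of_nonneg_right hA_le hZ0
    _ = K * bigP D ^ 17 * ε := by rw [hK]; ring
    _ ≤ Real.exp (Real.log (K + 1)) * bigP D ^ 17 * ε := by
        apply mul_le_mul_of_nonneg_right _ hε0.le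
        exact mul_le_mul_of_nonneg_right hKexp (by positivity)
    _ = Real.exp (Real.log (K + 1) + 17 * Skeleton.ell D ^ 9 + -c₀ * Skeleton.ell D ^ 10) := by
        rw [hP17, hε, Real.exp_add, Real.exp_add]
    _ ≤ Real.exp (-(c₀ / 2) * Skeleton.ell D ^ 10) := Real.exp_le_exp.mpr (by linarith)

end Literature.NumberTheory.LFunctions.Zhang2022.Section7cStatements
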